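import Summits.CriticalPhenomena.PercolationContinuityZ3.Theorems.PercNearOneGluingNoHeavyQuantWindowExtremePieces
import HarnessLib

/-!
# QUANT lane R8, T-DEC: extreme points of the window polytope are small — the case of a saturated layer with NO mass above the top
# layer (memo WINDOW-ATOMS-G57 §2.4 case (B), file H5 part 6)

builds on p205010 (kernel theorem, internal audit signed; external expert review pending)

Support file (`--supports stmt-CriticalPhenomena-4575`), QUANT lane seat prim-quant-census-2 (gen 57), rung R8 of
`run/shared/lean/prim/quant/LADDER.md`.  One theorem, standard axioms, no sorries.

* **`LawDec.smallLaw_of_tight_noGiant`** — `v` extreme in `windowSet x T M j w` (`0 < x < 1`); `J*` the LARGEST unflipped window layer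
  whose giant pool is nonempty and exactly saturated; no position above `j` carries mass.  Then `SmallLaw T j M (vecLaw M v)`.
  Saturation gives a corner segment `σ₀ = (l₀, h₀)` beyond `J*` (no leftovers exist); then either its rate is `u` (the piece `b_{σ₀}` alone),
  or some absorber beyond `J*` has residual capacity (pieces `b_{σ₀} + (u − c₀)e_{h₂}`), or a second segment `σ′` beyond `J*` exists (pieces
  `(c′ − u)b_{σ₀} + (u − c₀)b_{σ′}`), or — the remaining configuration — the pool of `J*` consists of the full column `h₀` alone and
  saturation reads `u F₀ = c₀ F₀`, contradicting `c₀ ≠ u`.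

[this work]; nothing here is cited as a published result.  The gluing rows served [cite: KozmaNitzan2024, Conjecture 3 (p. 15)]; product
measure [cite: Grimmett1999, §1.3 p. 10].
-/

noncomputable section

namespace Summit.CriticalPhenomena.PercolationContinuityZ3.Theorems

namespace Quant

open Finset

namespace LawDec

/-- indicator of equality of naturals, as a real number -/
local notation3 "𝟙[" a ", " b "]" => (if (a : ℕ) = (b : ℕ) then (1 : ℝ) else 0)

/-- **THE SATURATED CASE WITHOUT MASS ABOVE THE TOP LAYER** (memo §2.4 (B)). [this work] -/
theorem smallLaw_of_tight_noGiant (x T : ℝ) (M j w : ℕ) (v : Fin (M + 1) → ℝ) (hx0 : 0 < x) (hx1 : x < 1)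
    (hvext : v ∈ (windowSet x T M j w).extremePoints ℝ) (Js : ℕ)
    (hgap : ∀ l, Js < l → l ≤ j → 2 * (l : ℝ) < T → vecLaw M v l = 0)
    (hS : x / (1 - x) * windowS x T j M (vecLaw M v) Js = ∑ h ∈ Finset.Ico (Js + 1) (M + 1), vecLaw M v h)
    (hΓ : 0 < ∑ h ∈ Finset.Ico (Js + 1) (M + 1), vecLaw M v h)
    (hmax : ∀ J, J ≤ j → j ≤ J + w → (∀ l, J < l → l ≤ j → 2 * (l : ℝ) < T → vecLaw M v l = 0) →
      x / (1 - x) * windowS x T j M (vecLaw M v) J = ∑ h ∈ Finset.Ico (J + 1) (M + 1), vecLaw M v h →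
      0 < ∑ h ∈ Finset.Ico (J + 1) (M + 1), vecLaw M v h → J ≤ Js)
    (hnogiant : ∀ g, j < g → g ≤ M → vecLaw M v g = 0) :
    SmallLaw T j M (vecLaw M v) := by
  classical
  have hv : v ∈ windowSet x T M j w := hvext.1
  set μ : ℕ → ℝ := vecLaw M v with hμdef
  have hμ0 : ∀ k, 0 ≤ μ k := fun k => by
    by_cases hk : k < M + 1
    · rw [hμdef, vecLaw_apply_of_lt v hk]; exact hv.1 _
    · rw [hμdef, vecLaw, dif_neg hk]
  have hμM : ∀ h, M < h → μ h = 0 := fun h hh => vecLaw_apply_of_gt v hh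
  have hμ1 : ∑ h ∈ Finset.range (M + 1), μ h = 1 := by rw [hμdef, sum_range_vecLaw, hv.2.1]
  have hwin : ∀ J, J ≤ j → j ≤ J + w → DECAtT x T J M μ := hv.2.2
  have hu : 0 < x / (1 - x) := div_pos hx0 (by linarith)
  obtain ⟨hF0, hsup, hrow, hcol⟩ := cornerFlow_inv x T j M μ hx0 hx1 hμ0 ((j + 1) * (j + 1)) le_rfl
  have hleM : ∀ b, 0 < μ b → b ≤ M := fun b hb => by
    by_contra hgt; push Not at hgt; linarith [hμM b hgt]
  have hleft0 : ∀ l, 0 ≤ cornerLeftover x T j M μ l := fun l => by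
    unfold cornerLeftover cornerMidFlow; linarith [hrow l]
  have hterm0 : ∀ a h, 0 ≤ usage x T j a h * cornerMidFlow x T j M μ a h := fun a h => by
    by_cases hz : cornerMidFlow x T j M μ a h = 0
    · rw [hz, mul_zero]
    · obtain ⟨-, -, q3, -, q5, -⟩ := hsup a h hz
      have hah : a < h := by
        by_contra hge; push Not at hge
        have : (h : ℝ) ≤ a := by exact_mod_cast hge
        linarith
      exact mul_nonneg (usage_pos_of_compat x T j a h hx0 hx1 q3 hah (Or.inr q5)).le (hF0 a h)
  have hlowM : ∀ l h, 0 < cornerMidFlow x T j M μ l h → l ≤ M := fun l h hF => by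
    obtain ⟨-, -, -, q4, -, -⟩ := hsup l h (ne_of_gt hF)
    have hle := Finset.single_le_sum (f := fun b => cornerFlow x T j M μ ((j + 1) * (j + 1)) l b) (fun b _ => hF0 l b)
      (Finset.mem_range.2 (Nat.lt_succ_of_le q4))
    have hF' : 0 < cornerFlow x T j M μ ((j + 1) * (j + 1)) l h := hF
    exact hleM l (by linarith [hrow l])
  -- no giant mass: every leftover vanishes
  have hΓj : ∑ h ∈ Finset.Ico (j + 1) (M + 1), μ h = 0 :=
    Finset.sum_eq_zero fun h hh => by
      obtain ⟨q1, q2⟩ := Finset.mem_Ico.1 hh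
      exact hnogiant h (by omega) (by omega)
  have hCj := (decAtT_iff_cornerSucceeds x T j M μ hx0 hx1 hμ0 hμM hμ1).1 (hwin j le_rfl (Nat.le_add_right _ _))
  unfold CornerSucceeds at hCj
  rw [hΓj] at hCj
  have hLz : ∀ l, l ≤ j → 2 * (l : ℝ) < T → cornerLeftover x T j M μ l = 0 := by
    have h0 : 0 ≤ ∑ l ∈ (Finset.range (j + 1)).filter (fun l : ℕ => 2 * (l : ℝ) < T), cornerLeftover x T j M μ l :=
      Finset.sum_nonneg fun l _ => hleft0 l
    have hz : ∑ l ∈ (Finset.range (j + 1)).filter (fun l : ℕ => 2 * (l : ℝ) < T), cornerLeftover x T j M μ l = 0 := by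
      nlinarith
    exact fun l hl hlow => (Finset.sum_eq_zero_iff_of_nonneg (fun l _ => hleft0 l)).1 hz l
      (Finset.mem_filter.2 ⟨Finset.mem_range.2 (Nat.lt_succ_of_le hl), hlow⟩)
  -- saturation yields a segment beyond `J*`
  have hSpos : 0 < windowS x T j M μ Js := by
    by_contra hle; push Not at hle; nlinarith
  obtain ⟨l₀, hl₀mem, hl₀ne⟩ := Finset.exists_ne_zero_of_sum_ne_zero (ne_of_gt hSpos)
  obtain ⟨hl₀r, hl₀low⟩ := Finset.mem_filter.1 hl₀mem
  have hl₀j : l₀ ≤ j := Nat.lt_succ_iff.1 (Finset.mem_range.1 hl₀r)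
  rw [hLz l₀ hl₀j hl₀low, zero_add] at hl₀ne
  obtain ⟨h₀, hh₀mem, hh₀ne⟩ := Finset.exists_ne_zero_of_sum_ne_zero hl₀ne
  have hcond : Js < h₀ ∧ h₀ ≤ j := by
    by_contra hc; rw [if_neg hc] at hh₀ne; exact hh₀ne rfl
  rw [if_pos hcond] at hh₀ne
  have hF : 0 < cornerMidFlow x T j M μ l₀ h₀ := lt_of_le_of_ne (hF0 l₀ h₀) (Ne.symm hh₀ne)
  obtain ⟨q1, q2, q3, q4, q5, -⟩ := hsup l₀ h₀ hh₀ne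
  have hl₀M : l₀ ≤ M := hlowM l₀ h₀ hF
  have hl₀h₀ : l₀ ≠ h₀ := by
    intro e; have : (l₀ : ℝ) = h₀ := by exact_mod_cast e
    linarith
  set c₀ := usage x T j l₀ h₀ with hc₀
  have hc₀pos : 0 < c₀ := usage_pos_of_compat x T j l₀ h₀ hx0 hx1 q3 (by
    by_contra hge; push Not at hge; have : (h₀ : ℝ) ≤ l₀ := by exact_mod_cast hge
    linarith) (Or.inr q5)
  by_cases hcu : c₀ = x / (1 - x)
  · -- (B i) the segment alone is a two-sided move
    refine smallLaw_of_pieces x T M j w v hx0 hx1 hvext l₀ h₀ 0 0 0 0 0 1 0 0 0 0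
      (fun _ => hF) (fun h => absurd rfl h) (fun h => absurd rfl h) (fun h => absurd rfl h) (fun h => absurd rfl h)
      (fun J h1 h2 h3 h4 h5 => ?_) l₀ hl₀M ?_ l₀ l₀ h₀ h₀ q4 q4 (Or.inl (by linarith)) (Or.inl (by linarith)) (fun k hk => ?_)
    · have hJle : J ≤ Js := hmax J h1 h2 h3 h4 h5
      unfold pieceG
      rw [if_pos (show J < h₀ ∧ h₀ ≤ M from ⟨by omega, q4⟩), if_pos (show J < h₀ by omega)]
      simp only [zero_mul, mul_zero, ite_self]
      rw [← hc₀, hcu]; ring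
    · unfold pertLaw; rw [if_pos rfl, if_neg hl₀h₀]; simp
    · rcases pert_support x T j μ l₀ h₀ 0 0 0 0 0 1 0 0 0 0 k hk with ⟨-, hk'⟩ | ⟨ht, -⟩ | ⟨hs, -⟩ | ⟨hs, -⟩ | ⟨hr, -⟩
      · rcases hk' with e | e
        · exact Or.inl e
        · exact Or.inr (Or.inr (Or.inl e))
      · exact absurd rfl ht
      · exact absurd rfl hs
      · exact absurd rfl hs
      · exact absurd rfl hr
  by_cases hres : ∃ h₂, μ h₂ ≠ 0 ∧ Js < h₂ ∧ h₂ ≤ j ∧ ¬ (2 * (h₂ : ℝ) < T) ∧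
      0 < μ h₂ - ∑ a ∈ Finset.range (j + 1), usage x T j a h₂ * cornerMidFlow x T j M μ a h₂
  · -- (B ii) an absorber beyond `J*` with residual capacity
    obtain ⟨h₂, hμ2, hJ2, h2j, hnl2, hres2⟩ := hres
    have h2M : h₂ ≤ M := hleM h₂ (lt_of_le_of_ne (hμ0 h₂) (Ne.symm hμ2))
    have hl₀h₂ : l₀ ≠ h₂ := by intro e; rw [e] at hl₀low; exact hnl2 hl₀low
    refine smallLaw_of_pieces x T M j w v hx0 hx1 hvext l₀ h₀ 0 0 h₂ 0 0 1 0 (x / (1 - x) - c₀) 0 0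
      (fun _ => hF) (fun h => absurd rfl h)
      (fun _ => ⟨h2M, fun hc => hnl2 hc.1, hres2⟩) (fun h => absurd rfl h) (fun h => absurd rfl h)
      (fun J h1 h2 h3 h4 h5 => ?_) l₀ hl₀M ?_ l₀ l₀ h₀ h₂ q4 h2M (Or.inl (by linarith)) (Or.inl (not_lt.1 hnl2)) (fun k hk => ?_)
    · have hJle : J ≤ Js := hmax J h1 h2 h3 h4 h5
      unfold pieceG
      rw [if_pos (show J < h₀ ∧ h₀ ≤ M from ⟨by omega, q4⟩), if_pos (show J < h₀ by omega),
        if_pos (show J < h₂ ∧ h₂ ≤ M from ⟨by omega, h2M⟩)]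
      simp only [zero_mul, mul_zero, ite_self]
      ring
    · unfold pertLaw; rw [if_pos rfl, if_neg hl₀h₀, if_neg hl₀h₂]; simp
    · rcases pert_support x T j μ l₀ h₀ 0 0 h₂ 0 0 1 0 (x / (1 - x) - c₀) 0 0 k hk with ⟨-, hk'⟩ | ⟨ht, -⟩ | ⟨-, hk'⟩ | ⟨hs, -⟩ | ⟨hr, -⟩
      · rcases hk' with e | e
        · exact Or.inl e
        · exact Or.inr (Or.inr (Or.inl e))
      · exact absurd rfl ht
      · exact Or.inr (Or.inr (Or.inr hk'))
      · exact absurd rfl hs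
      · exact absurd rfl hr
  by_cases hseg2 : ∃ l' h', 0 < cornerMidFlow x T j M μ l' h' ∧ Js < h' ∧ h' ≤ j ∧ ¬ (l' = l₀ ∧ h' = h₀)
  · -- (B iii) a second segment beyond `J*`
    obtain ⟨l', h', hF', hJ', h'j, hne'⟩ := hseg2
    obtain ⟨p1, p2, p3, p4, p5, -⟩ := hsup l' h' (ne_of_gt hF')
    have hl'M : l' ≤ M := hlowM l' h' hF'
    set c' := usage x T j l' h' with hc'
    have hc'pos : 0 < c' := usage_pos_of_compat x T j l' h' hx0 hx1 p3 (by
      by_contra hge; push Not at hge; have : (h' : ℝ) ≤ l' := by exact_mod_cast hge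
      linarith) (Or.inr p5)
    have hl'h₀ : l' ≠ h₀ := by
      intro e; have : (l' : ℝ) = h₀ := by exact_mod_cast e
      linarith
    have hl'h' : l' ≠ h' := by
      intro e; have : (l' : ℝ) = h' := by exact_mod_cast e
      linarith
    have hh'l₀ : h' ≠ l₀ := by
      intro e; have : (h' : ℝ) = l₀ := by exact_mod_cast e
      linarith
    have ht₂ : x / (1 - x) - c₀ ≠ 0 := fun h => hcu (by linarith)
    -- a position where the pieces move mass
    have hb : ∃ b, b ≤ M ∧ pertLaw x T j μ l₀ h₀ l' h' 0 0 0 (c' - x / (1 - x)) (x / (1 - x) - c₀) 0 0 0 b - μ b ≠ 0 := by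
      by_cases hh' : h' = h₀
      · have hl'l₀ : l' ≠ l₀ := fun e => hne' ⟨e, hh'⟩
        refine ⟨l', hl'M, ?_⟩
        unfold pertLaw
        rw [if_neg hl'l₀, if_neg hl'h₀, if_pos rfl, if_neg hl'h']
        intro h; apply ht₂; linarith
      · refine ⟨h', p4, ?_⟩
        unfold pertLaw
        rw [if_neg hh'l₀, if_neg hh', if_neg (Ne.symm hl'h'), if_pos rfl]
        intro h
        have : (x / (1 - x) - c₀) * c' = 0 := by linarith
        rcases mul_eq_zero.1 this with h1 | h1
        · exact ht₂ h1
        · linarith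
    obtain ⟨b, hbM, hbne⟩ := hb
    refine smallLaw_of_pieces x T M j w v hx0 hx1 hvext l₀ h₀ l' h' 0 0 0 (c' - x / (1 - x)) (x / (1 - x) - c₀) 0 0 0
      (fun _ => hF) (fun _ => hF') (fun h => absurd rfl h) (fun h => absurd rfl h) (fun h => absurd rfl h)
      (fun J h1 h2 h3 h4 h5 => ?_) b hbM hbne l₀ l' h₀ h' q4 p4 (Or.inl (by linarith)) (Or.inl (by linarith)) (fun k hk => ?_)
    · have hJle : J ≤ Js := hmax J h1 h2 h3 h4 h5
      unfold pieceG
      rw [if_pos (show J < h₀ ∧ h₀ ≤ M from ⟨by omega, q4⟩), if_pos (show J < h₀ by omega),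
        if_pos (show J < h' ∧ h' ≤ M from ⟨by omega, p4⟩), if_pos (show J < h' by omega)]
      simp only [mul_zero, ite_self]
      ring
    · rcases pert_support x T j μ l₀ h₀ l' h' 0 0 0 (c' - x / (1 - x)) (x / (1 - x) - c₀) 0 0 0 k hk with
        ⟨-, hk'⟩ | ⟨-, hk'⟩ | ⟨hs, -⟩ | ⟨hs, -⟩ | ⟨hr, -⟩
      · rcases hk' with e | e
        · exact Or.inl e
        · exact Or.inr (Or.inr (Or.inl e))
      · rcases hk' with e | e
        · exact Or.inr (Or.inl e)
        · exact Or.inr (Or.inr (Or.inr e))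
      · exact absurd rfl hs
      · exact absurd rfl hs
      · exact absurd rfl hr
  · -- (B iv) the remaining configuration contradicts `c₀ ≠ u`
    exfalso
    push Not at hres hseg2
    -- every position beyond `J*` other than `h₀` is massless
    have hzero : ∀ h, Js < h → h ≠ h₀ → μ h = 0 := by
      intro h hJh hne
      by_contra hμh
      have hpos : 0 < μ h := lt_of_le_of_ne (hμ0 h) (Ne.symm hμh)
      have hhM : h ≤ M := hleM h hpos
      have hhj : h ≤ j := by
        by_contra hgt; push Not at hgt; exact hμh (hnogiant h hgt hhM)
      have hnl : ¬ (2 * (h : ℝ) < T) := fun hlow => hμh (hgap h hJh hhj hlow)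
      have hr := hres h hμh hJh hhj (not_lt.1 hnl)
      -- full: mass = load, and the load comes from segments beyond `J*`, all equal to `σ₀`
      have hload0 : ∑ a ∈ Finset.range (j + 1), usage x T j a h * cornerMidFlow x T j M μ a h = 0 := by
        refine Finset.sum_eq_zero fun a _ => ?_
        by_cases hz : cornerMidFlow x T j M μ a h = 0
        · rw [hz, mul_zero]
        · exact absurd (hseg2 a h (lt_of_le_of_ne (hF0 a h) (Ne.symm hz)) hJh hhj).2 hne
      rw [hload0] at hr
      linarith
    -- the pool of `J*` is `μ h₀ = c₀ F₀`
    have hΓ' : ∑ h ∈ Finset.Ico (Js + 1) (M + 1), μ h = μ h₀ := by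
      rw [Finset.sum_eq_single h₀]
      · intro h hh hne; exact hzero h (Finset.mem_Ico.1 hh).1 hne
      · intro hn; exact absurd (Finset.mem_Ico.2 ⟨hcond.1, Nat.lt_succ_of_le q4⟩) hn
    have hμh₀ : μ h₀ = c₀ * cornerMidFlow x T j M μ l₀ h₀ := by
      have hload : ∑ a ∈ Finset.range (j + 1), usage x T j a h₀ * cornerMidFlow x T j M μ a h₀
          = c₀ * cornerMidFlow x T j M μ l₀ h₀ := by
        rw [Finset.sum_eq_single l₀]
        · intro a _ hne
          by_cases hz : cornerMidFlow x T j M μ a h₀ = 0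
          · rw [hz, mul_zero]
          · exact absurd (hseg2 a h₀ (lt_of_le_of_ne (hF0 a h₀) (Ne.symm hz)) hcond.1 hcond.2).1 hne
        · intro hn; exact absurd (Finset.mem_range.2 (Nat.lt_succ_of_le q1)) hn
      have hcol' : ∑ a ∈ Finset.range (j + 1), usage x T j a h₀ * cornerMidFlow x T j M μ a h₀ ≤ μ h₀ := hcol h₀
      rw [hload] at hcol'
      have hμpos : μ h₀ ≠ 0 := by
        have : 0 < c₀ * cornerMidFlow x T j M μ l₀ h₀ := mul_pos hc₀pos hF
        intro hz; linarith
      have h2 : T ≤ 2 * (h₀ : ℝ) := by linarith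
      have hr := hres h₀ hμpos hcond.1 hcond.2 h2
      rw [hload] at hr
      linarith
    -- the leftover mass of `J*` is `F₀`
    have hS' : windowS x T j M μ Js = cornerMidFlow x T j M μ l₀ h₀ := by
      unfold windowS
      rw [Finset.sum_eq_single l₀]
      · rw [hLz l₀ hl₀j hl₀low, zero_add, Finset.sum_eq_single h₀]
        · rw [if_pos hcond]
        · intro h _ hne
          by_cases hc : Js < h ∧ h ≤ j
          · rw [if_pos hc]
            by_contra hz
            exact hne (hseg2 l₀ h (lt_of_le_of_ne (hF0 l₀ h) (Ne.symm hz)) hc.1 hc.2).2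
          · rw [if_neg hc]
        · intro hn; exact absurd (Finset.mem_range.2 (Nat.lt_succ_of_le q4)) hn
      · intro l hl hne
        obtain ⟨r1, r2⟩ := Finset.mem_filter.1 hl
        rw [hLz l (Nat.lt_succ_iff.1 (Finset.mem_range.1 r1)) r2, zero_add]
        refine Finset.sum_eq_zero fun h _ => ?_
        by_cases hc : Js < h ∧ h ≤ j
        · rw [if_pos hc]
          by_contra hz
          exact hne (hseg2 l h (lt_of_le_of_ne (hF0 l h) (Ne.symm hz)) hc.1 hc.2).1
        · rw [if_neg hc]
      · intro hn; exact absurd hl₀mem hn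
    rw [hS', hΓ', hμh₀] at hS
    have : (x / (1 - x) - c₀) * cornerMidFlow x T j M μ l₀ h₀ = 0 := by linarith
    rcases mul_eq_zero.1 this with h1 | h1
    · exact hcu (by linarith)
    · linarith

end LawDec

end Quant

end Summit.CriticalPhenomena.PercolationContinuityZ3.Theorems
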